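import Literature.InformationTheory.QuantumCodes.CSS
import HarnessLib

/-!
# Direct sums of CSS codes: `[[Σ nᵢ, Σ kᵢ, min dᵢ]]`

"The direct sum of two additive codes is defined in the natural way: `C ⊕ C′ = {uv : u ∈ C, v ∈ C′}`.
In this way we can form the direct sum of two quantum-error-correcting codes, combining `[[n,k,d]]`
and `[[n′,k′,d′]]` codes to produce an `[[n+n′, k+k′, d″]]` code, where `d″ = min{d,d′}`"
[CalderbankEtAl1998, §4]. For CSS codes presented by check matrices (the tree's `CSSCode RX RZ Q`,
`CSS.lean`) the direct sum of a finite family `C : o → CSSCode RX RZ Q` is the code on the disjoint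
union `Q × o` of the qubit sets whose check matrices are BLOCK DIAGONAL,
`H^X = diag(H^X₁, …)`, `H^Z = diag(H^Z₁, …)` (`Matrix.blockDiagonal`). This is the shape in which a
disconnected two-block group-algebra code "is decomposed into smaller mutually disconnected subcodes"
[LinPryadko2024, §4.3], used by the qec census (census/SYMMETRIES.md (s4)) to INHERIT the parameters
of an imprimitive pair from its primitive root (`TwoBlockCosetDecomposition.lean`).

Proved here (no named facts):

* `CSSCode.directSum C` (block-diagonal check matrices; commutation blockwise);
* blockwise transport: `blockDiagonal_mulVec_eq_zero_iff`, `mem_rowSpace_blockDiagonal_iff`,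
  the component / extension maps `block`, `extend` with their kernel, row-space and weight lemmas;
* `X`- and `Z`-logicals of the sum ↔ logicals of a component (`exists_xLogical_directSum_iff`, …), the
  bounds `directSum_dX_le_hammingNorm`, `le_directSum_dX` (and `Z` twins), and for a CONSTANT family
  (`r` copies of one code) **`directSum_const_dX`, `directSum_const_dZ` : `d^X`, `d^Z` unchanged**;
* dimension: `finrank_pcCode_blockDiagonal` (kernel of a block-diagonal matrix = product of the
  kernels), **`directSum_k : k(⊕ Cᵢ) = Σ kᵢ`**, `directSum_const_k : k = r · k(C)`.

## References (locators read on the page)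

* [CalderbankEtAl1998] A. R. Calderbank, E. M. Rains, P. W. Shor, N. J. A. Sloane, *Quantum error
  correction via codes over GF(4)*, IEEE Trans. Inform. Theory 44 (1998) 1369 = arXiv:quant-ph/9608006,
  §4 "General constructions" (held text chunk p0013 L24–27: the direct sum, `[[n+n′, k+k′, min{d,d′}]]`).
* [LinPryadko2024] H.-K. Lin, L. P. Pryadko, PRA 109 (2024) 022407 = arXiv:2306.16400, §4.3 (chunk
  p0010 L1–13: block structure of `H_X`, `H_Z` by double cosets; "the code LP[a,b] is decomposed into
  smaller mutually disconnected subcodes"; L34–36 "decomposition of the 2BGA code into a direct sum of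
  individual double-coset subcodes").
-/

namespace Literature.InformationTheory.QuantumCodes

open Matrix

/-! ### Block-diagonal check matrices: kernel and row space are componentwise -/

section BlockDiagonal

variable {o R Q : Type*} [Fintype o] [Fintype R] [Fintype Q] [DecidableEq o]

/-- The `k`-th component `(j ↦ v (j, k))` of a vector on the disjoint union `Q × o`.
[cite: CalderbankEtAl1998, §4 "C ⊕ C′ = {uv : u ∈ C, v ∈ C′}" (arXiv:quant-ph/9608006 chunk p0013 L24)] -/
def block (v : Q × o → ZMod 2) (k : o) : Q → ZMod 2 := fun j => v (j, k)

omit [Fintype o] [Fintype Q] [DecidableEq o] in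
/-- `block v k j = v (j, k)`. [cite: CalderbankEtAl1998, §4 (arXiv:quant-ph/9608006 chunk p0013 L24)] -/
@[simp] theorem block_apply (v : Q × o → ZMod 2) (k : o) (j : Q) : block v k j = v (j, k) := rfl

/-- Extension by zero of a vector on component `k₀` to the disjoint union (`u ↦ u0⋯0`).
[cite: CalderbankEtAl1998, §4 "C ⊕ C′ = {uv : u ∈ C, v ∈ C′}" (arXiv:quant-ph/9608006 chunk p0013 L24)] -/
def extend (k₀ : o) (u : Q → ZMod 2) : Q × o → ZMod 2 := fun p => if p.2 = k₀ then u p.1 else 0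

omit [Fintype o] [Fintype Q] in
/-- `extend k₀ u (j, k) = if k = k₀ then u j else 0`. [cite: CalderbankEtAl1998, §4 (arXiv:quant-ph/9608006 chunk p0013 L24)] -/
@[simp] theorem extend_apply (k₀ : o) (u : Q → ZMod 2) (j : Q) (k : o) :
    extend k₀ u (j, k) = if k = k₀ then u j else 0 := rfl

omit [Fintype o] [Fintype Q] in
/-- The `k₀`-th block of the extension is `u`, the others vanish.
[cite: CalderbankEtAl1998, §4 (arXiv:quant-ph/9608006 chunk p0013 L24)] -/
theorem block_extend (k₀ : o) (u : Q → ZMod 2) (k : o) :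
    block (extend k₀ u) k = if k = k₀ then u else 0 := by
  funext j
  by_cases h : k = k₀ <;> simp [h]

omit [Fintype o] [Fintype Q] [DecidableEq o] in
/-- A vector on the disjoint union is the sum of its blocks placed in their components; in particular
it is determined by its blocks. [cite: CalderbankEtAl1998, §4 (arXiv:quant-ph/9608006 chunk p0013 L24)] -/
theorem eq_of_block_eq {v w : Q × o → ZMod 2} (h : ∀ k, block v k = block w k) : v = w := by
  funext ⟨j, k⟩
  exact congr_fun (h k) j

omit [Fintype R] in
/-- Block-diagonal matrices act blockwise: `(diag(M) v)_{(i,k)} = (M_k v_k)_i`.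
[cite: LinPryadko2024, §4.3 "the row of matrix H_X labeled by the group element x is in the block associated with the double coset" (arXiv:2306.16400 chunk p0010 L1–8)] -/
theorem blockDiagonal_mulVec_block (M : o → Matrix R Q (ZMod 2)) (v : Q × o → ZMod 2) (i : R) (k : o) :
    (blockDiagonal M *ᵥ v) (i, k) = (M k *ᵥ block v k) i := by
  simp only [mulVec, dotProduct, blockDiagonal_apply, block_apply]
  rw [Fintype.sum_prod_type]
  simp only [ite_mul, zero_mul, Finset.sum_ite_eq, Finset.mem_univ, if_true]

omit [Fintype R] in
/-- **Kernel is componentwise**: `diag(M) v = 0 ↔ ∀ k, M_k v_k = 0`.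
[cite: LinPryadko2024, §4.3 (arXiv:2306.16400 chunk p0010 L1–13)] -/
theorem blockDiagonal_mulVec_eq_zero_iff (M : o → Matrix R Q (ZMod 2)) (v : Q × o → ZMod 2) :
    blockDiagonal M *ᵥ v = 0 ↔ ∀ k, M k *ᵥ block v k = 0 := by
  constructor
  · intro h k
    funext i
    have := congr_fun h (i, k)
    rwa [blockDiagonal_mulVec_block] at this
  · intro h
    funext ⟨i, k⟩
    rw [blockDiagonal_mulVec_block, h k]
    rfl

omit [Fintype Q] in
/-- Row combinations of a block-diagonal matrix are componentwise:
`(w diag(M))_{(j,k)} = (w_k M_k)_j`. [cite: LinPryadko2024, §4.3 (arXiv:2306.16400 chunk p0010 L1–13)] -/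
theorem vecMul_blockDiagonal_block (M : o → Matrix R Q (ZMod 2)) (w : R × o → ZMod 2) (k : o) :
    block (w ᵥ* blockDiagonal M) k = block w k ᵥ* M k := by
  funext j
  simp only [block_apply, vecMul, dotProduct, blockDiagonal_apply]
  rw [Fintype.sum_prod_type]
  simp only [mul_ite, mul_zero, Finset.sum_ite_eq', Finset.mem_univ, if_true]

omit [Fintype Q] in
/-- **Row space is componentwise**: `v ∈ rs diag(M) ↔ ∀ k, v_k ∈ rs M_k`.
[cite: LinPryadko2024, §4.3 (arXiv:2306.16400 chunk p0010 L1–13)] -/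
theorem mem_rowSpace_blockDiagonal_iff (M : o → Matrix R Q (ZMod 2)) (v : Q × o → ZMod 2) :
    v ∈ rowSpace (blockDiagonal M) ↔ ∀ k, block v k ∈ rowSpace (M k) := by
  constructor
  · intro h k
    obtain ⟨w, hw⟩ := (mem_rowSpace_iff _ _).1 h
    exact (mem_rowSpace_iff _ _).2 ⟨block w k, by rw [← vecMul_blockDiagonal_block, hw]⟩
  · intro h
    choose w hw using fun k => (mem_rowSpace_iff _ _).1 (h k)
    refine (mem_rowSpace_iff _ _).2 ⟨fun p => w p.2 p.1, eq_of_block_eq fun k => ?_⟩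
    rw [vecMul_blockDiagonal_block, ← hw k]
    rfl

omit [Fintype o] [DecidableEq o] in
/-- The weight of a block is at most the weight of the whole vector.
[cite: CalderbankEtAl1998, §4 (arXiv:quant-ph/9608006 chunk p0013 L24–27)] -/
theorem hammingNorm_block_le [Fintype o] (v : Q × o → ZMod 2) (k : o) :
    hammingNorm (block v k) ≤ hammingNorm v := by
  unfold hammingNorm
  refine Finset.card_le_card_of_injOn (fun j => (j, k)) (fun j hj => ?_) (fun j₁ _ j₂ _ h => ?_)
  · simpa using hj
  · simpa using h

omit [Fintype o] in
/-- Extension by zero preserves the weight. [cite: CalderbankEtAl1998, §4 (arXiv:quant-ph/9608006 chunk p0013 L24–27)] -/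
theorem hammingNorm_extend [Fintype o] (k₀ : o) (u : Q → ZMod 2) :
    hammingNorm (extend k₀ u) = hammingNorm u := by
  unfold hammingNorm
  symm
  refine Finset.card_bij (fun j _ => (j, k₀)) (fun j hj => by simpa using hj)
    (fun j₁ _ j₂ _ h => by simpa using h) (fun p hp => ?_)
  obtain ⟨j, k⟩ := p
  simp only [Finset.mem_filter, Finset.mem_univ, true_and, extend_apply] at hp
  by_cases hk : k = k₀
  · subst hk
    exact ⟨j, by simpa using hp, rfl⟩
  · exact absurd (by simp [hk]) hp

/-- **Kernel of a block-diagonal matrix = product of the kernels** (a linear equivalence).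
[cite: LinPryadko2024, §4.3 "decomposition of the 2BGA code into a direct sum of individual double-coset subcodes" (arXiv:2306.16400 chunk p0010 L34–36)] -/
noncomputable def pcCodeBlockDiagonalEquiv (M : o → Matrix R Q (ZMod 2)) :
    pcCode (blockDiagonal M) ≃ₗ[ZMod 2] ((k : o) → pcCode (M k)) where
  toFun v := fun k => ⟨block v.1 k, (blockDiagonal_mulVec_eq_zero_iff M v.1).1 v.2 k⟩
  map_add' _ _ := rfl
  map_smul' _ _ := rfl
  invFun u := ⟨fun p => (u p.2).1 p.1,
    (blockDiagonal_mulVec_eq_zero_iff M _).2 fun k => (u k).2⟩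
  left_inv _ := rfl
  right_inv _ := rfl

omit [Fintype R] in
/-- `dim ker diag(M) = Σ_k dim ker M_k`. [cite: LinPryadko2024, §4.3 (arXiv:2306.16400 chunk p0010 L34–36)] -/
theorem finrank_pcCode_blockDiagonal (M : o → Matrix R Q (ZMod 2)) :
    Module.finrank (ZMod 2) (pcCode (blockDiagonal M)) =
      ∑ k, Module.finrank (ZMod 2) (pcCode (M k)) := by
  rw [(pcCodeBlockDiagonalEquiv M).finrank_eq, Module.finrank_pi_fintype]

end BlockDiagonal

/-! ### The direct sum of a finite family of CSS codes -/

namespace CSSCode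

variable {o RX RZ Q : Type*} [Fintype o] [Fintype Q] [DecidableEq o]

/-- **Direct sum** `⊕_k C_k` of CSS codes: qubits `Q × o`, block-diagonal check matrices.
[cite: CalderbankEtAl1998, §4 "the direct sum of two quantum-error-correcting codes" (arXiv:quant-ph/9608006 chunk p0013 L24–27)] -/
def directSum (C : o → CSSCode RX RZ Q) : CSSCode (RX × o) (RZ × o) (Q × o) where
  HX := blockDiagonal fun k => (C k).HX
  HZ := blockDiagonal fun k => (C k).HZ
  comm := by
    rw [blockDiagonal_transpose, ← blockDiagonal_mul]
    have : (fun k => (C k).HX * ((C k).HZ)ᵀ) = 0 := funext fun k => (C k).comm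
    rw [this, blockDiagonal_zero]

/-- `(directSum C).HX = diag(H^X_k)`. [cite: CalderbankEtAl1998, §4 (arXiv:quant-ph/9608006 chunk p0013 L24–27)] -/
@[simp] theorem directSum_HX (C : o → CSSCode RX RZ Q) :
    (directSum C).HX = blockDiagonal fun k => (C k).HX := rfl

/-- `(directSum C).HZ = diag(H^Z_k)`. [cite: CalderbankEtAl1998, §4 (arXiv:quant-ph/9608006 chunk p0013 L24–27)] -/
@[simp] theorem directSum_HZ (C : o → CSSCode RX RZ Q) :
    (directSum C).HZ = blockDiagonal fun k => (C k).HZ := rfl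

/-- The direct sum commutes with the `X ↔ Z` exchange (definitional).
[cite: CalderbankEtAl1998, §4 (arXiv:quant-ph/9608006 chunk p0013 L24–27)] -/
theorem directSum_swap (C : o → CSSCode RX RZ Q) :
    (directSum C).swap = directSum fun k => (C k).swap := rfl

/-! #### `X`-logicals of the sum versus the components -/

/-- A block of an `X`-logical candidate of the sum lies in the component's `ker H^Z`; all blocks of a
stabilizer are stabilizers. So: `V` is an `X`-logical of `⊕ C_k` iff every block is in `ker H^Z_k` and
SOME block is not in `rs H^X_k`. [cite: CalderbankEtAl1998, §4 (arXiv:quant-ph/9608006 chunk p0013 L24–27)] -/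
theorem xLogical_directSum_iff [Fintype RX] (C : o → CSSCode RX RZ Q) (V : Q × o → ZMod 2) :
    ((directSum C).HZ *ᵥ V = 0 ∧ V ∉ (directSum C).rowSpX) ↔
      ((∀ k, (C k).HZ *ᵥ block V k = 0) ∧ ∃ k, block V k ∉ (C k).rowSpX) := by
  rw [directSum_HZ, blockDiagonal_mulVec_eq_zero_iff, CSSCode.rowSpX, directSum_HX,
    mem_rowSpace_blockDiagonal_iff, not_forall]

/-- From an `X`-logical of the sum, an `X`-logical of some component of no larger weight.
[cite: CalderbankEtAl1998, §4 "d″ = min{d, d′}" (arXiv:quant-ph/9608006 chunk p0013 L26)] -/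
theorem exists_xLogical_block [Fintype RX] (C : o → CSSCode RX RZ Q) {V : Q × o → ZMod 2}
    (hV : (directSum C).HZ *ᵥ V = 0) (hV' : V ∉ (directSum C).rowSpX) :
    ∃ k, (C k).HZ *ᵥ block V k = 0 ∧ block V k ∉ (C k).rowSpX ∧ hammingNorm (block V k) ≤ hammingNorm V := by
  obtain ⟨hker, k, hk⟩ := (xLogical_directSum_iff C V).1 ⟨hV, hV'⟩
  exact ⟨k, hker k, hk, hammingNorm_block_le V k⟩

/-- From an `X`-logical of a component, an `X`-logical of the sum of the same weight (extend by zero).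
[cite: CalderbankEtAl1998, §4 "d″ = min{d, d′}" (arXiv:quant-ph/9608006 chunk p0013 L26)] -/
theorem xLogical_extend [Fintype RX] (C : o → CSSCode RX RZ Q) (k₀ : o) {u : Q → ZMod 2} (hu : (C k₀).HZ *ᵥ u = 0)
    (hu' : u ∉ (C k₀).rowSpX) :
    (directSum C).HZ *ᵥ extend k₀ u = 0 ∧ extend k₀ u ∉ (directSum C).rowSpX := by
  refine (xLogical_directSum_iff C _).2 ⟨fun k => ?_, k₀, ?_⟩
  · rw [block_extend]
    by_cases h : k = k₀
    · subst h; simpa using hu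
    · simp [h]
  · rw [block_extend, if_pos rfl]
    exact hu'

/-- The sum has an `X`-logical iff some component has one.
[cite: CalderbankEtAl1998, §4 (arXiv:quant-ph/9608006 chunk p0013 L24–27)] -/
theorem exists_xLogical_directSum_iff [Fintype RX] (C : o → CSSCode RX RZ Q) :
    (∃ V, (directSum C).HZ *ᵥ V = 0 ∧ V ∉ (directSum C).rowSpX) ↔
      ∃ k, ∃ u, (C k).HZ *ᵥ u = 0 ∧ u ∉ (C k).rowSpX := by
  constructor
  · rintro ⟨V, hV, hV'⟩
    obtain ⟨k, h1, h2, -⟩ := exists_xLogical_block C hV hV'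
    exact ⟨k, block V k, h1, h2⟩
  · rintro ⟨k, u, hu, hu'⟩
    exact ⟨extend k u, xLogical_extend C k hu hu'⟩

/-- **`d^X(⊕ C_k) ≤ |u|`** for every `X`-logical `u` of any component.
[cite: CalderbankEtAl1998, §4 "d″ = min{d, d′}" (arXiv:quant-ph/9608006 chunk p0013 L26)] -/
theorem directSum_dX_le_hammingNorm [Fintype RX] (C : o → CSSCode RX RZ Q) (k₀ : o) {u : Q → ZMod 2}
    (hu : (C k₀).HZ *ᵥ u = 0) (hu' : u ∉ (C k₀).rowSpX) : (directSum C).dX ≤ hammingNorm u := by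
  have h := xLogical_extend C k₀ hu hu'
  rw [← hammingNorm_extend k₀ u]
  exact (directSum C).dX_le_hammingNorm h.1 h.2

/-- `d^X(⊕ C_k) ≤ d^X(C_{k₀})` for every component that has an `X`-logical.
[cite: CalderbankEtAl1998, §4 "d″ = min{d, d′}" (arXiv:quant-ph/9608006 chunk p0013 L26)] -/
theorem directSum_dX_le [Fintype RX] (C : o → CSSCode RX RZ Q) (k₀ : o)
    (hex : ∃ u, (C k₀).HZ *ᵥ u = 0 ∧ u ∉ (C k₀).rowSpX) : (directSum C).dX ≤ (C k₀).dX := by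
  obtain ⟨u, hu, hu', hud⟩ := (C k₀).exists_hammingNorm_eq_dX hex
  rw [← hud]
  exact directSum_dX_le_hammingNorm C k₀ hu hu'

/-- **Lower bound**: if every `X`-logical of every component has weight `≥ d` (and some component has
one), then `d ≤ d^X(⊕ C_k)`. [cite: CalderbankEtAl1998, §4 "d″ = min{d, d′}" (arXiv:quant-ph/9608006 chunk p0013 L26)] -/
theorem le_directSum_dX [Fintype RX] (C : o → CSSCode RX RZ Q) {d : ℕ}
    (hex : ∃ k, ∃ u, (C k).HZ *ᵥ u = 0 ∧ u ∉ (C k).rowSpX)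
    (h : ∀ k u, (C k).HZ *ᵥ u = 0 → u ∉ (C k).rowSpX → d ≤ hammingNorm u) : d ≤ (directSum C).dX := by
  refine (directSum C).le_dX ((exists_xLogical_directSum_iff C).2 hex) fun V hV hV' => ?_
  obtain ⟨k, h1, h2, h3⟩ := exists_xLogical_block C hV hV'
  exact (h k _ h1 h2).trans h3

/-- **`r` copies of one code have its `X`-distance**: `d^X(C ⊕ ⋯ ⊕ C) = d^X(C)` (`o` nonempty).
[cite: CalderbankEtAl1998, §4 "d″ = min{d, d′}" (arXiv:quant-ph/9608006 chunk p0013 L26)] -/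
theorem directSum_const_dX [Fintype RX] [Nonempty o] (C : CSSCode RX RZ Q) : (directSum fun _ : o => C).dX = C.dX := by
  obtain ⟨k₀⟩ := ‹Nonempty o›
  by_cases hex : ∃ u, C.HZ *ᵥ u = 0 ∧ u ∉ C.rowSpX
  · refine le_antisymm (directSum_dX_le (fun _ : o => C) k₀ hex) ?_
    exact le_directSum_dX (fun _ : o => C) ⟨k₀, hex⟩ fun _ u hu hu' => C.dX_le_hammingNorm hu hu'
  · have h0 : C.dX = 0 := by
      have := C.dX_pos_iff.not.2 hex
      omega
    have h0' : (directSum fun _ : o => C).dX = 0 := by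
      have := (directSum fun _ : o => C).dX_pos_iff.not.2
        (fun hV => hex (((exists_xLogical_directSum_iff fun _ : o => C).1 hV).elim fun _ h => h))
      omega
    rw [h0, h0']

/-! #### `Z` side (via the `X ↔ Z` exchange) -/

/-- `d^Z(⊕ C_k) ≤ |u|` for every `Z`-logical `u` of a component. [cite: CalderbankEtAl1998, §4 "d″ = min{d, d′}" (arXiv:quant-ph/9608006 chunk p0013 L26)] -/
theorem directSum_dZ_le_hammingNorm [Fintype RZ] (C : o → CSSCode RX RZ Q) (k₀ : o) {u : Q → ZMod 2}
    (hu : (C k₀).HX *ᵥ u = 0) (hu' : u ∉ (C k₀).rowSpZ) : (directSum C).dZ ≤ hammingNorm u :=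
  directSum_dX_le_hammingNorm (fun k => (C k).swap) k₀ hu hu'

/-- Lower bound on `d^Z(⊕ C_k)` from componentwise lower bounds. [cite: CalderbankEtAl1998, §4 "d″ = min{d, d′}" (arXiv:quant-ph/9608006 chunk p0013 L26)] -/
theorem le_directSum_dZ [Fintype RZ] (C : o → CSSCode RX RZ Q) {d : ℕ}
    (hex : ∃ k, ∃ u, (C k).HX *ᵥ u = 0 ∧ u ∉ (C k).rowSpZ)
    (h : ∀ k u, (C k).HX *ᵥ u = 0 → u ∉ (C k).rowSpZ → d ≤ hammingNorm u) : d ≤ (directSum C).dZ :=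
  le_directSum_dX (fun k => (C k).swap) hex h

/-- The sum has a `Z`-logical iff some component has one. [cite: CalderbankEtAl1998, §4 (arXiv:quant-ph/9608006 chunk p0013 L24–27)] -/
theorem exists_zLogical_directSum_iff [Fintype RZ] (C : o → CSSCode RX RZ Q) :
    (∃ V, (directSum C).HX *ᵥ V = 0 ∧ V ∉ (directSum C).rowSpZ) ↔
      ∃ k, ∃ u, (C k).HX *ᵥ u = 0 ∧ u ∉ (C k).rowSpZ :=
  exists_xLogical_directSum_iff fun k => (C k).swap

/-- **`r` copies of one code have its `Z`-distance**. [cite: CalderbankEtAl1998, §4 "d″ = min{d, d′}" (arXiv:quant-ph/9608006 chunk p0013 L26)] -/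
theorem directSum_const_dZ [Fintype RZ] [Nonempty o] (C : CSSCode RX RZ Q) : (directSum fun _ : o => C).dZ = C.dZ :=
  directSum_const_dX C.swap

/-! #### Dimension -/

/-- **`k(⊕ C_k) = Σ_k k(C_k)`**. [cite: CalderbankEtAl1998, §4 "an [[n + n′, k + k′, d″]] code" (arXiv:quant-ph/9608006 chunk p0013 L26)] -/
theorem directSum_k [Fintype RX] [Fintype RZ] (C : o → CSSCode RX RZ Q) : (directSum C).k = ∑ k, (C k).k := by
  -- per component: `k + |Q| = dim ker H^X + dim ker H^Z`
  have comp : ∀ D : CSSCode RX RZ Q,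
      D.k + Fintype.card Q = Module.finrank (ZMod 2) (pcCode D.HX) + Module.finrank (ZMod 2) (pcCode D.HZ) := by
    intro D
    have h1 := rank_add_finrank_pcCode D.HX
    have h2 := rank_add_finrank_pcCode D.HZ
    have h3 := D.rank_HX_add_rank_HZ_le
    have h4 := D.k_eq
    omega
  have hsum : (directSum C).k + Fintype.card (Q × o) =
      Module.finrank (ZMod 2) (pcCode (directSum C).HX) + Module.finrank (ZMod 2) (pcCode (directSum C).HZ) := by
    have h1 := rank_add_finrank_pcCode (directSum C).HX
    have h2 := rank_add_finrank_pcCode (directSum C).HZ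
    have h3 := (directSum C).rank_HX_add_rank_HZ_le
    have h4 := (directSum C).k_eq
    omega
  rw [directSum_HX, directSum_HZ, finrank_pcCode_blockDiagonal, finrank_pcCode_blockDiagonal,
    Fintype.card_prod, ← Finset.sum_add_distrib] at hsum
  have hc : ∑ k, ((C k).k + Fintype.card Q) = (∑ k, (C k).k) + Fintype.card Q * Fintype.card o := by
    rw [Finset.sum_add_distrib, Finset.sum_const, Finset.card_univ, smul_eq_mul, mul_comm]
  have : ∑ k, (Module.finrank (ZMod 2) (pcCode (C k).HX) + Module.finrank (ZMod 2) (pcCode (C k).HZ)) =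
      ∑ k, ((C k).k + Fintype.card Q) := Finset.sum_congr rfl fun k _ => (comp (C k)).symm
  omega

/-- **`k` of `r` copies is `r · k`**. [cite: CalderbankEtAl1998, §4 "an [[n + n′, k + k′, d″]] code" (arXiv:quant-ph/9608006 chunk p0013 L26)] -/
theorem directSum_const_k [Fintype RX] [Fintype RZ] (C : CSSCode RX RZ Q) : (directSum fun _ : o => C).k = Fintype.card o * C.k := by
  rw [directSum_k, Finset.sum_const, Finset.card_univ, smul_eq_mul]

omit [DecidableEq o] in
/-- The qubit count of `r` copies is `r · n`. [cite: CalderbankEtAl1998, §4 "an [[n + n′, k + k′, d″]] code" (arXiv:quant-ph/9608006 chunk p0013 L26)] -/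
theorem card_directSum_qubits : Fintype.card (Q × o) = Fintype.card o * Fintype.card Q := by
  rw [Fintype.card_prod, mul_comm]

end CSSCode

end Literature.InformationTheory.QuantumCodes
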